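import Mathlib
import HarnessLib
import Summits.ResolutionOfSingularities.ResolutionOfSingularities.Theorems.WildQuotientsWildQuotientResolutionS1aAuxTop
import Summits.ResolutionOfSingularities.ResolutionOfSingularities.Theorems.WildQuotientsWildQuotientResolutionS1aModelDim

/-!
# S1a — THE TOP COMPONENTS OF THE NON-KILLABLE LOCUS: the `Z`-clause of `AuxTopAt` is free

[OURS · L1 W4.5c · lead-1 g8; plan-1 g12 STRATEGY-DESIGN v3.5 §1 «for `Z =` all top components this holds by Noetherian finiteness»] — NOT statements of
the manuscript; counted 0; AI-level work, weaker than expert review. Crux stmt-ResolutionOfSingularities-17941, line `s1a-logminvertex` v6.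

Pure topology (`TopComponents` namespace): `topPart X k` := the union of the irreducible components of `X` of dimension `≥ k`;
`length_le_topologicalKrullDim_of_subset` (a chain of irreducible closed subsets inside `C` is no longer than `dim C`),
★ `topologicalKrullDim_compl_lt` (`dim (X ∖ Z) < k` for every `Z` containing the components of dimension `≥ k`), `preimage_topPart`
(homeomorphisms preserve `topPart`), `isClosed_topPart` (Noetherian).
Models (`GameFrame.GModel`): `topNonKillable M k ⊆ nonKillable M` — closed (quasi-compact model), `G`-stable, with
`dim (nonKillable M ∖ topNonKillable M k) < k` for every `k`; hence ★ `auxTopAt_of_topNonKillable`: to prove `AuxTopAt M` (with `jInf M = k`) it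
suffices to give an AUX centre whose support CONTAINS `topNonKillable M k` and over whose support every bad point of every move is killable; datum form
`AuxSuppTopReach p` + `auxTopReach_of_auxSuppTopReach`.
-/

set_option linter.dupNamespace false

noncomputable section

open CategoryTheory Limits AlgebraicGeometry TopologicalSpace Topology
open Literature.AlgebraicGeometry.Resolution Literature.AlgebraicGeometry.RelativeSpec
open Summit.ResolutionOfSingularities.ResolutionOfSingularities.Theorems.WildQuotientResolution.S1
open Summit.ResolutionOfSingularities.ResolutionOfSingularities.Theorems.WildQuotientResolution.S1.NodeAtlas

namespace Summit.ResolutionOfSingularities.ResolutionOfSingularities.Theorems.WildQuotientResolution.S1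

/-! ## Topology: the top-dimensional part -/

namespace TopComponents

variable {X Y : Type*} [TopologicalSpace X] [TopologicalSpace Y]

/-- **`topPart X k`** — the union of the irreducible components of `X` of dimension `≥ k`. [OURS · L1 W4.5c] -/
def topPart (X : Type*) [TopologicalSpace X] (k : ℕ) : Set X :=
  ⋃ C ∈ {C : Set X | C ∈ irreducibleComponents X ∧ (k : WithBot ℕ∞) ≤ topologicalKrullDim ↥C}, C

/-- A component of dimension `≥ k` lies in `topPart X k`. -/
theorem subset_topPart {k : ℕ} {C : Set X} (hC : C ∈ irreducibleComponents X) (hk : (k : WithBot ℕ∞) ≤ topologicalKrullDim ↥C) :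
    C ⊆ topPart X k :=
  Set.subset_biUnion_of_mem (u := fun D : Set X => D)
    (show C ∈ {D : Set X | D ∈ irreducibleComponents X ∧ (k : WithBot ℕ∞) ≤ topologicalKrullDim ↥D} from ⟨hC, hk⟩)

/-- Membership in `topPart`. -/
theorem mem_topPart_iff {k : ℕ} {x : X} :
    x ∈ topPart X k ↔ ∃ C ∈ irreducibleComponents X, (k : WithBot ℕ∞) ≤ topologicalKrullDim ↥C ∧ x ∈ C := by
  simp only [topPart, Set.mem_iUnion, Set.mem_setOf_eq, exists_prop, and_assoc]

/-- `topPart` is closed when `X` has finitely many irreducible components (e.g. `X` Noetherian). -/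
theorem isClosed_topPart [NoetherianSpace X] (k : ℕ) : IsClosed (topPart X k) :=
  (NoetherianSpace.finite_irreducibleComponents.subset fun _ hC => hC.1).isClosed_biUnion
    fun C hC => isClosed_of_mem_irreducibleComponents C hC.1

/-- The preimage in `↥C` of a preirreducible subset of `C` is preirreducible. -/
theorem isPreirreducible_preimage_val {C T : Set X} (hT : IsPreirreducible T) (hTC : T ⊆ C) :
    IsPreirreducible (Subtype.val ⁻¹' T : Set ↥C) := by
  rintro _ _ ⟨u, hu, rfl⟩ ⟨v, hv, rfl⟩ ⟨⟨x, hxC⟩, hxT, hxu⟩ ⟨⟨y, hyC⟩, hyT, hyv⟩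
  obtain ⟨z, hzT, hzu, hzv⟩ := hT u v hu hv ⟨x, hxT, hxu⟩ ⟨y, hyT, hyv⟩
  exact ⟨⟨z, hTC hzT⟩, hzT, hzu, hzv⟩

/-- **A chain of irreducible closed subsets of `X` inside `C` is no longer than `dim C`.** -/
theorem length_le_topologicalKrullDim_of_subset (C : Set X) (l : LTSeries (IrreducibleCloseds X)) (h : ∀ i, (l i : Set X) ⊆ C) :
    (l.length : WithBot ℕ∞) ≤ topologicalKrullDim ↥C := by
  let f : Fin (l.length + 1) → IrreducibleCloseds ↥C := fun i =>
    { carrier := Subtype.val ⁻¹' (l i : Set X)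
      isIrreducible' := ⟨by obtain ⟨x, hx⟩ := (l i).isIrreducible.nonempty; exact ⟨⟨x, h i hx⟩, hx⟩,
        isPreirreducible_preimage_val (l i).isIrreducible.isPreirreducible (h i)⟩
      isClosed' := (l i).isClosed.preimage continuous_subtype_val }
  have hf : ∀ i j, l i < l j → f i < f j := fun i j hij => by
    refine lt_of_le_of_ne (fun x hx => hij.le hx) fun heq => hij.ne ?_
    have hc : (Subtype.val ⁻¹' (l i : Set X) : Set ↥C) = Subtype.val ⁻¹' (l j : Set X) :=
      congrArg (fun T : IrreducibleCloseds ↥C => (T : Set ↥C)) heq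
    rw [Subtype.preimage_coe_eq_preimage_coe_iff, Set.inter_eq_right.mpr (h i), Set.inter_eq_right.mpr (h j)] at hc
    exact IrreducibleCloseds.ext hc
  let l' : LTSeries (IrreducibleCloseds ↥C) := ⟨l.length, f, fun i => hf _ _ (l.step i)⟩
  exact Order.LTSeries.length_le_krullDim l'

/-- ★ **Removing the top components drops the dimension**: if `Z` contains every irreducible component of dimension `≥ k`, then
`dim (X ∖ Z) < k`. [OURS · L1 W4.5c] -/
theorem topologicalKrullDim_compl_lt (k : ℕ) (Z : Set X)
    (hZ : ∀ C ∈ irreducibleComponents X, (k : WithBot ℕ∞) ≤ topologicalKrullDim ↥C → C ⊆ Z) :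
    topologicalKrullDim ↥(Zᶜ) < k := by
  rw [topologicalKrullDim, Order.krullDim_lt_coe_iff]
  intro l
  have hι : IsInducing (Subtype.val : ↥(Zᶜ) → X) := IsInducing.subtypeVal
  have hF : StrictMono (IrreducibleCloseds.map (Subtype.val : ↥(Zᶜ) → X) hι.continuous) :=
    IrreducibleCloseds.map_strictMono_of_isInducing hι
  let l₁ := l.map _ hF
  -- the last member of the pushed chain lies in a component `C`
  obtain ⟨C, hC, hLC⟩ := exists_mem_irreducibleComponents_subset_of_isIrreducible (l₁.last : Set X) l₁.last.isIrreducible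
  have hall : ∀ i, (l₁ i : Set X) ⊆ C := fun i x hx => hLC (l₁.monotone (Fin.le_last i) hx)
  by_cases htop : (k : WithBot ℕ∞) ≤ topologicalKrullDim ↥C
  · -- `C ⊆ Z`, but the last member of `l` has a point off `Z`
    exfalso
    obtain ⟨y, hy⟩ := l.last.isIrreducible.nonempty
    have h1 : (y : X) ∈ (l₁.last : Set X) := by
      rw [LTSeries.last_map, IrreducibleCloseds.coe_map]
      exact subset_closure ⟨y, hy, rfl⟩
    exact y.2 (hZ C hC htop (hLC h1))
  · have h2 := length_le_topologicalKrullDim_of_subset C l₁ hall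
    rw [LTSeries.map_length] at h2
    have h3 : (l.length : WithBot ℕ∞) < k := lt_of_le_of_lt h2 (not_le.mp htop)
    exact_mod_cast h3

/-- A homeomorphism pulls back a component of dimension `≥ k` to one. -/
theorem preimage_mem_of_top (ψ : X ≃ₜ Y) {k : ℕ} {C : Set Y} (hC : C ∈ irreducibleComponents Y)
    (hk : (k : WithBot ℕ∞) ≤ topologicalKrullDim ↥C) :
    ψ ⁻¹' C ∈ irreducibleComponents X ∧ (k : WithBot ℕ∞) ≤ topologicalKrullDim ↥(ψ ⁻¹' C) := by
  refine ⟨preimage_mem_irreducibleComponents hC ψ.isOpenEmbedding (by rw [ψ.range_coe, Set.inter_univ]; exact hC.1.nonempty), ?_⟩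
  rw [IsHomeomorph.topologicalKrullDim_eq _ (Homeomorph.isHomeomorph (ψ.sets (s := ψ ⁻¹' C) (t := C) rfl))]
  exact hk

/-- **Homeomorphisms preserve the top part.** -/
theorem preimage_topPart (ψ : X ≃ₜ Y) (k : ℕ) : ψ ⁻¹' topPart Y k = topPart X k := by
  ext x
  rw [Set.mem_preimage, mem_topPart_iff, mem_topPart_iff]
  constructor
  · rintro ⟨C, hC, hk, hx⟩
    obtain ⟨hC', hk'⟩ := preimage_mem_of_top ψ hC hk
    exact ⟨ψ ⁻¹' C, hC', hk', hx⟩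
  · rintro ⟨C, hC, hk, hx⟩
    obtain ⟨hC', hk'⟩ := preimage_mem_of_top ψ.symm hC hk
    exact ⟨ψ.symm ⁻¹' C, hC', hk', by rw [Set.mem_preimage, ψ.symm_apply_apply]; exact hx⟩

/-- `⊥ ≠ x ≤ n` in `WithBot ℕ∞` ⇒ `x` is a natural number. -/
theorem exists_nat_eq_of_ne_bot_of_le {x : WithBot ℕ∞} {n : ℕ} (h1 : x ≠ ⊥) (h2 : x ≤ n) : ∃ k : ℕ, x = k := by
  induction x using WithBot.recBotCoe with
  | bot => exact absurd rfl h1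
  | coe y =>
    induction y using ENat.recTopCoe with
    | top =>
      exfalso
      rw [← WithBot.coe_natCast, WithBot.coe_le_coe] at h2
      exact ENat.coe_ne_top n (top_le_iff.mp h2)
    | coe m => exact ⟨m, rfl⟩

end TopComponents

/-! ## Models: the top components of the non-killable locus -/

namespace GameFrame.GModel

open TopComponents

variable {p : ℕ} {X' X₁ : Scheme.{0}} {q : X' ⟶ X₁} {G : Type} [Group G] {ρ : G →* Aut X'} {g₀ : G}

/-- **`topNonKillable M k`** — the union of the irreducible components of `nonKillable M` of dimension `≥ k`, as a subset of `M.V` (intended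
`k = jInf M`: the top components). [OURS · L1 W4.5c] -/
def topNonKillable (M : GModel p q G ρ g₀) (k : ℕ) : Set M.V :=
  Subtype.val '' topPart ↥M.nonKillable k

/-- `topNonKillable ⊆ nonKillable`. -/
theorem topNonKillable_subset (M : GModel p q G ρ g₀) (k : ℕ) : M.topNonKillable k ⊆ M.nonKillable := by
  rintro _ ⟨x, -, rfl⟩
  exact x.2

/-- `topNonKillable` is closed (quasi-compact model: the non-killable locus is Noetherian). -/
theorem isClosed_topNonKillable (M : GModel p q G ρ g₀) [CompactSpace M.V] (k : ℕ) : IsClosed (M.topNonKillable k) := by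
  haveI := M.noetherianSpace_nonKillable
  exact M.isClosed_nonKillable.isClosedEmbedding_subtypeVal.isClosedMap _ (isClosed_topPart k)

/-- `topNonKillable` is `G`-stable. -/
theorem preimage_aut_topNonKillable (M : GModel p q G ρ g₀) (g : G) (k : ℕ) :
    (M.act.aut g).hom.base ⁻¹' M.topNonKillable k = M.topNonKillable k := by
  let φ : M.V ≃ₜ M.V := Scheme.homeoOfIso (M.act.aut g)
  have hφ : ∀ x, φ x = (M.act.aut g).hom.base x := fun _ => rfl
  let ψ : ↥M.nonKillable ≃ₜ ↥M.nonKillable :=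
    φ.subtype (p := (· ∈ M.nonKillable)) (q := (· ∈ M.nonKillable)) fun x => by
      rw [hφ]; exact (M.aut_base_mem_nonKillable_iff g x).symm
  have hψ : ∀ x : ↥M.nonKillable, ((ψ x : ↥M.nonKillable) : M.V) = (M.act.aut g).hom.base x := fun _ => rfl
  have hpre := preimage_topPart ψ k
  ext x
  constructor
  · rintro ⟨y, hy, hyx⟩
    have hxN : x ∈ M.nonKillable := (M.aut_base_mem_nonKillable_iff g x).mp (hyx ▸ y.2)
    refine ⟨⟨x, hxN⟩, ?_, rfl⟩
    have heq : ψ ⟨x, hxN⟩ = y := Subtype.ext (by rw [hψ]; exact hyx.symm)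
    rw [← hpre, Set.mem_preimage, heq]
    exact hy
  · rintro ⟨y, hy, rfl⟩
    refine ⟨ψ y, ?_, hψ y⟩
    rw [← hpre, Set.mem_preimage] at hy
    exact hy

/-- ★ **`dim (nonKillable M ∖ topNonKillable M k) < k`** for every `k`. [OURS · L1 W4.5c] -/
theorem topologicalKrullDim_nonKillable_diff_lt (M : GModel p q G ρ g₀) (k : ℕ) :
    topologicalKrullDim ↥(M.nonKillable \ M.topNonKillable k) < k := by
  have h1 : topologicalKrullDim ↥((topPart ↥M.nonKillable k)ᶜ) < k :=
    topologicalKrullDim_compl_lt k _ fun C hC hCk => subset_topPart hC hCk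
  let f₀ : ↥(M.nonKillable \ M.topNonKillable k) → ↥M.nonKillable := fun v => ⟨v.1, v.2.1⟩
  have hf₀ : IsInducing f₀ := IsInducing.subtypeVal.codRestrict fun v => v.2.1
  have hmem : ∀ v, f₀ v ∈ (topPart ↥M.nonKillable k)ᶜ := fun v h => v.2.2 ⟨f₀ v, h, rfl⟩
  exact lt_of_le_of_lt (hf₀.codRestrict hmem).topologicalKrullDim_le h1

/-- ★ **THE `Z`-CLAUSE OF `AuxTopAt` IS FREE**: with `jInf M = k`, an AUX centre whose support CONTAINS the top components `topNonKillable M k` and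
over whose support every bad point of every move is killable gives `AuxTopAt M`. [OURS · L1 W4.5c] -/
theorem auxTopAt_of_topNonKillable (M : GModel p q G ρ g₀) [CompactSpace M.V] {k : ℕ} (hk : M.jInf = k)
    {𝒦 : ReesFiltration M.V} {d : ℕ} (haux : IsAuxCentre p M.act g₀ 𝒦 d (M.badLocus)ᶜ)
    (hZ : M.topNonKillable k ⊆ ((𝒦.ideal d).support : Set M.V))
    (hkill : ∀ (M' : GModel p q G ρ g₀) (π' : M'.V ⟶ M.V), IsBlowup π' (𝒦.ideal d) → M'.π = π' ≫ M.π → M'.r = π' ≫ M.r →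
        (∀ g : G, (M'.act.aut g).hom ≫ π' = π' ≫ (M.act.aut g).hom) →
        ∀ v' ∈ M'.badLocus, π'.base v' ∈ ((𝒦.ideal d).support : Set M.V) → M'.KillableAt v') :
    M.AuxTopAt :=
  ⟨𝒦, d, haux, M.topNonKillable k, M.isClosed_topNonKillable k, fun g => M.preimage_aut_topNonKillable g k, M.topNonKillable_subset k,
    by rw [hk]; exact M.topologicalKrullDim_nonKillable_diff_lt k, hZ, hkill⟩

/-- A model of finite type over a field is quasi-compact. -/
theorem compactSpace_of_datum {k : Type} [Field k] (f : X₁ ⟶ Spec (.of k)) [QuasiCompact f] [IsFinite q] (M : GModel p q G ρ g₀) :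
    CompactSpace M.V := by
  haveI := M.isProper
  have hr : M.r = M.π ≫ q := M.r_eq
  haveI : QuasiCompact (M.r ≫ f) := by rw [hr]; infer_instance
  exact (HasAffineProperty.iff_of_isAffine (P := @QuasiCompact)).mp ‹QuasiCompact (M.r ≫ f)›

end GameFrame.GModel

/-! ## Datum form -/

/-- **`AuxSuppTopReach p`** (OURS CANDIDATE research statement, asserted nowhere; `AuxTopReach` with the `Z`-clause discharged): at every non-terminal
model reachable from the initial model of a crux datum with `jInf = k : ℕ`, there is an AUX centre `(𝒦, d)` whose SUPPORT CONTAINS THE TOP COMPONENTS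
`topNonKillable M k` of the non-killable locus, such that along every move of `(𝒦, d)` every bad point over the support is killable. (Census recipes:
STRATEGY-DESIGN v3.5 §2.) [OURS · L1 W4.5c] -/
def AuxSuppTopReach (p : ℕ) : Prop :=
  ∀ (k : Type) [Field k] [CharP k p] [PerfectField k] (X' X₁ : Scheme.{0})
    (f : X₁ ⟶ Spec (.of k)) (q : X' ⟶ X₁) (G : Type) [Group G] [Finite G]
    (ρ : G →* Aut X'), Nat.card G = p → IsSeparated f → LocallyOfFiniteType f → QuasiCompact f →
    IsIntegral X₁ → ∀ [IsIntegral X'], Scheme.IsRegular X' → IsFinite q → Function.Surjective q.base →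
    (∃ U : X₁.Opens, Dense (U : Set X₁) ∧ Etale (q ∣_ U)) →
    ∀ (hq : ∀ g : G, (ρ g).hom ≫ q = q),
    (∀ x y : X', q.base x = q.base y → ∃ g : G, (ρ g).hom.base x = y) →
    topologicalKrullDim X₁ ≤ 4 → Function.Injective ρ →
    ∀ (g₀ : G), (∀ g : G, g ∈ Subgroup.zpowers g₀) → ∀ [IsLocallyNoetherian X']
      (h₀ : NodeAtlas p (⟨ρ, hq⟩ : ActionOver q G) g₀),
      ∀ M : GameFrame.GModel p q G ρ g₀, (GameFrame.GModel.initial hq h₀).Reachable M → ¬ M.Terminal →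
        ∀ n : ℕ, M.jInf = n →
        ∃ (𝒦 : ReesFiltration M.V) (d : ℕ), IsAuxCentre p M.act g₀ 𝒦 d (M.badLocus)ᶜ ∧
          M.topNonKillable n ⊆ ((𝒦.ideal d).support : Set M.V) ∧
          ∀ (M' : GameFrame.GModel p q G ρ g₀) (π' : M'.V ⟶ M.V), IsBlowup π' (𝒦.ideal d) → M'.π = π' ≫ M.π → M'.r = π' ≫ M.r →
            (∀ g : G, (M'.act.aut g).hom ≫ π' = π' ≫ (M.act.aut g).hom) →
            ∀ v' ∈ M'.badLocus, π'.base v' ∈ ((𝒦.ideal d).support : Set M.V) → M'.KillableAt v'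

/-- **`AuxSuppTopReach p ⇒ AuxTopReach p`** (on crux data `jInf ≠ ⊥` is a natural number `≤ 4`, and the `Z`-clause is free). [OURS · L1 W4.5c] -/
theorem auxTopReach_of_auxSuppTopReach {p : ℕ} (h : AuxSuppTopReach p) : AuxTopReach p := by
  intro k _ _ _ X' X₁ f q G _ _ ρ hG hfs hfft hfqc hX₁ _ hreg hqfin hqs hqet hq horb hdim hinj g₀ hg₀ _ h₀ M hR hT hj
  haveI := hfqc
  haveI := hqfin
  haveI : CompactSpace M.V := GameFrame.GModel.compactSpace_of_datum f M
  obtain ⟨n, hn⟩ := TopComponents.exists_nat_eq_of_ne_bot_of_le hj (M.jInf_le_four_of_datum hqs hdim)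
  obtain ⟨𝒦, d, haux, hZ, hkill⟩ := h k X' X₁ f q G ρ hG hfs hfft hfqc hX₁ hreg hqfin hqs hqet hq horb hdim hinj g₀ hg₀ h₀ M hR hT n hn
  exact M.auxTopAt_of_topNonKillable hn haux hZ hkill

/-- **The residual with the free clause removed**: `KillHalfCoverReach p ∧ AuxSuppTopReach p ⇒ KillOrAuxRuleJInfReach p`. [OURS · L1 W4.5c] -/
theorem killOrAuxRuleJInfReach_of_killHalfCoverReach_of_auxSuppTopReach {p : ℕ} (hp : p.Prime) (hK : KillHalfCoverReach p)
    (hA : AuxSuppTopReach p) : KillOrAuxRuleJInfReach p :=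
  killOrAuxRuleJInfReach_of_killHalfCoverReach_of_auxTopReach hp hK (auxTopReach_of_auxSuppTopReach hA)

/-- plan-1 SIG KA v2 shape: **`KillHalfReach p ∧ AuxTopReach p ⇒ KillOrAuxRuleJInfReach p`** (so, with p610439, `stub_winningStrategy ⇐ KillHalfReach ∧
AuxTopReach` by name; (A3) is the theorem `GameFrame.GModel.auxAlt_of_auxTopAt`, p613609 — no `AuxAltOfAuxTopAt` hypothesis needed). [OURS · L1 W4.5c] -/
theorem killOrAuxRuleJInfReach_of_killHalfReach_of_auxTopReach {p : ℕ} (hp : p.Prime) (hK : KillHalfReach p) (hA : AuxTopReach p) :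
    KillOrAuxRuleJInfReach p :=
  killOrAuxRuleJInfReach_of_halves hK (auxHalfReach_of_auxTopReach hp hA)

end Summit.ResolutionOfSingularities.ResolutionOfSingularities.Theorems.WildQuotientResolution.S1

end
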